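import Summits.Ventures.YMGap.Thresholds.StarGeometry
import HarnessLib

/-!
# Venture YMGap — track (c) «DS»: STAR ADJACENCY — opposite / non-opposite star links, boundary
# links, and the tree's influence counts `tInfluence` on the vertex star (B4a, PLAN R95/R96)

HONEST FRAMING: venture file (cell `pub-ymgap`); pure lattice COMBINATORICS of the discrete torus
`(ℤ/L)^d` (continuing `StarGeometry.lean`), no measure, no `β`, no estimate, no
clustering/continuum/mass-gap claim. These are the facts (G1)–(G3) of the cell's B4-BLUEPRINT.md §1/§6
that the assembly `starWindowBound_lemmaG` (seat ds-4) uses to match the tree's Dobrushin coefficients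
`C(e, y) = K (|β|/N) · tInfluence e y` (`isKRContraction_torusWilson`) with the adjacency pattern of the
vertex star of `StarGaugeReceivedSum` (`Adj` = «not opposite»; each boundary link coupled to exactly
the two star links of its unique star plaquette).

## Contents (`s` a site, `Λ⋆ = DSWindow.vertexStar s`; `L ≥ 3` where stated)
* `sum_tstapleLinks_indicator`, `tInfluence_eq_jointPlaq` — for `y ≠ x` on a torus of side `≥ 2` the tree's influence count
  `tInfluence x y` IS the number of plaquettes containing both links (`jointPlaq`);
  `tInfluence_self` (`= 0`); `sum_linkNbrT_tInfluence_mul` — `Σ_{z ∈ linkNbrT x} tInfluence x z · w z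
  = Σ_{z ≠ x} jointPlaq x z · w z` (the adapter from the tree's index set `linkNbrT x` to any partition
  of the links). So every statement below transfers verbatim to `tInfluence`.
* `starLink s μ out` (the star link of direction `μ`, outgoing `(s, μ)` or incoming `(s − e_μ, μ)`),
  `starLink_mem_vertexStar`, `eq_starLink_of_mem_vertexStar`, `starLink_injective` (G1: the `2d` star
  links are pairwise distinct, `L ≥ 2`), `mem_vertexStar_iff'`.
* (G2) `jointPlaq_eq_zero_of_vertexStar_of_snd_eq` — OPPOSITE star links (same direction) share no
  plaquette (`L ≥ 2`); `jointPlaq_eq_one_of_vertexStar_of_snd_ne` — NON-OPPOSITE star links share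
  exactly one (`L ≥ 3`).
* (G3) `jointPlaq_eq_zero_of_not_mem_starBoundary` (a link off the star and its boundary is coupled
  to no star link); `jointPlaq_eq_zero_of_not_mem_starPlaq` + `starPlaq_eq_of_mem_boundary` — the star
  plaquette through a boundary link is UNIQUE (`L ≥ 3`), so a boundary link `y ∈ p_{ab}` is coupled
  (`jointPlaq = 1`, `jointPlaq_eq_one_of_mem`) to the two star links `a, b` of `p_{ab}` and to no other
  star link; `card_filter_not_mem_vertexStar` — every star plaquette has exactly TWO boundary links
  (with `StarKernel.filter_mem_vertexStar_plaqEdgesT`: exactly two star links).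

References: cell `pub-ymgap` ds/ds4/B4-BLUEPRINT.md §1, §6; ds/LEAN-KROW.md §1–§2; PLAN R95/R96;
E. Seiler, LNP 159 (1982) Ch. 2 (lattice conventions).
-/

noncomputable section

open Function Finset
open Literature.MathematicalPhysics.QuantumFieldTheory
open Literature.MathematicalPhysics.QuantumFieldTheory.Balaban1983to89.StrongCouplingTorusWindow
  (tLink1 tLink2 tLink3 tLink4 plaqEdgesT_eq tstapleLinks tInfluence tLink1_ne_tLink2 tLink1_ne_tLink3
  tLink1_ne_tLink4 tLink2_ne_tLink3 tLink2_ne_tLink4 tLink3_ne_tLink4)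
open Summit.Ventures.YMGap.DSWindow

namespace Summit.Ventures.YMGap.StarKernel

variable {d L : ℕ}

/-! ### The tree's influence count is the joint-plaquette multiplicity -/

section Influence

variable [NeZero L]

/-- **On a plaquette through `x`, the three staple links hit a link `y ≠ x` exactly `[y ∈ q]` times**
(the three `tstapleLinks` are the other three edges, pairwise distinct on a torus of side `≥ 2`). -/
theorem sum_tstapleLinks_indicator (hL : 1 < L) {q : Plaquette d L} {x y : Edge d L}
    (hx : x ∈ plaqEdgesT q) (hxy : y ≠ x) :
    (∑ k : Fin 3, if tstapleLinks q x k = y then 1 else 0) = if y ∈ plaqEdgesT q then 1 else 0 := by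
  have h12 := tLink1_ne_tLink2 q
  have h13 := tLink1_ne_tLink3 hL q
  have h14 := tLink1_ne_tLink4 q
  have h23 := tLink2_ne_tLink3 q
  have h24 := tLink2_ne_tLink4 hL q
  have h34 := tLink3_ne_tLink4 q
  have h21 := h12.symm; have h31 := h13.symm; have h41 := h14.symm
  have h32 := h23.symm; have h42 := h24.symm; have h43 := h34.symm
  simp only [plaqEdgesT_eq, mem_insert, mem_singleton] at hx ⊢
  rcases hx with rfl | rfl | rfl | rfl <;>
    simp only [tstapleLinks, h21, h31, h41, h32, h42, h43, ↓reduceIte, Fin.sum_univ_three,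
      Matrix.cons_val_zero, Matrix.cons_val_one, Matrix.cons_val_two, Matrix.head_cons,
      Matrix.tail_cons] <;>
    simp only [eq_comm (a := y)] <;>
    by_cases hy1 : tLink1 q = y <;> by_cases hy2 : tLink2 q = y <;> by_cases hy3 : tLink3 q = y <;>
      by_cases hy4 : tLink4 q = y <;>
        simp_all

/-- **The tree's influence count is the joint-plaquette multiplicity**: for `y ≠ x` on a torus of
side `≥ 2`, `tInfluence x y = jointPlaq x y` (the number of plaquettes containing both links). -/
theorem tInfluence_eq_jointPlaq (hL : 1 < L) {x y : Edge d L} (hxy : y ≠ x) :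
    tInfluence x y = jointPlaq x y := by
  unfold tInfluence jointPlaq
  rw [card_eq_sum_ones, sum_filter]
  exact sum_congr rfl fun q hq => sum_tstapleLinks_indicator hL (mem_plaqsThrough.1 hq) hxy

/-- A link does not influence itself: `tInfluence x x = 0` (torus of side `≥ 2`). -/
theorem tInfluence_self (hL : 1 < L) (x : Edge d L) : tInfluence x x = 0 := by
  unfold tInfluence
  refine sum_eq_zero fun q hq => sum_eq_zero fun k _ => ?_
  rw [mem_plaqsThrough, plaqEdgesT_eq, mem_insert, mem_insert, mem_insert, mem_singleton] at hq
  have h12 := tLink1_ne_tLink2 q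
  have h13 := tLink1_ne_tLink3 hL q
  have h14 := tLink1_ne_tLink4 q
  have h23 := tLink2_ne_tLink3 q
  have h24 := tLink2_ne_tLink4 hL q
  have h34 := tLink3_ne_tLink4 q
  rw [if_neg]
  rcases hq with rfl | rfl | rfl | rfl <;>
    fin_cases k <;>
    simp [tstapleLinks, h12, h13, h14, h23, h24, h34, h12.symm, h13.symm, h14.symm, h23.symm,
      h24.symm, h34.symm]

/-- A link `z ≠ x` off the plaquette neighbourhood of `x` shares no plaquette with `x`. -/
theorem jointPlaq_eq_zero_of_not_mem_linkNbrT {x z : Edge d L} (hzx : z ≠ x) (hz : z ∉ linkNbrT x) :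
    jointPlaq x z = 0 := by
  rw [jointPlaq_eq_zero_iff]
  intro q hx hz'
  exact hz (mem_linkNbrT_iff.2 ⟨hzx, q, hx, hz'⟩)

/-- **Adapter for sums over the plaquette neighbourhood** (the index set of the tree's Dobrushin
coefficients `C x z = c₀ · tInfluence x z`, `z ∈ linkNbrT x`): for any weight `w`,
`Σ_{z ∈ linkNbrT x} tInfluence x z · w z = Σ_{z ≠ x} jointPlaq x z · w z` (torus of side `≥ 2`) —
so such sums can be split over any partition of the links `≠ x` using the star lemmas below. -/
theorem sum_linkNbrT_tInfluence_mul (hL : 1 < L) (x : Edge d L) (w : Edge d L → ℝ) :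
    ∑ z ∈ linkNbrT x, (tInfluence x z : ℝ) * w z = ∑ z ∈ univ.erase x, (jointPlaq x z : ℝ) * w z := by
  rw [← sum_subset (s₁ := linkNbrT x) (s₂ := univ.erase x)
    (fun z hz => mem_erase.2 ⟨(mem_linkNbrT_iff.1 hz).1, mem_univ _⟩)
    (fun z hz hzn => by
      rw [jointPlaq_eq_zero_of_not_mem_linkNbrT (mem_erase.1 hz).1 hzn, Nat.cast_zero, zero_mul])]
  exact sum_congr rfl fun z hz => by rw [tInfluence_eq_jointPlaq hL (mem_linkNbrT_iff.1 hz).1]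

end Influence

/-! ### The `2d` star links: parametrization by (direction, orientation) -/

section Links

variable [NeZero L]

omit [NeZero L] in
/-- The **star link of direction `μ` at `s`**: outgoing `(s, μ)` if `out`, incoming `(s − e_μ, μ)`
otherwise (B4-BLUEPRINT: `OUT_μ`, `IN_μ`). -/
def starLink (s : Site d L) (μ : Fin d) (out : Bool) : Edge d L :=
  (if out then s else s - Pi.single μ 1, μ)

omit [NeZero L] in
/-- The direction of a star link. -/
@[simp] theorem starLink_snd (s : Site d L) (μ : Fin d) (out : Bool) : (starLink s μ out).2 = μ := rfl

/-- Star links lie in the vertex star. -/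
theorem starLink_mem_vertexStar (s : Site d L) (μ : Fin d) (out : Bool) :
    starLink s μ out ∈ vertexStar s := by
  rw [mem_vertexStar, mem_linkEnds]
  cases out
  · exact Or.inr (by simp [starLink, shift_def])
  · exact Or.inl (by simp [starLink])

/-- Every star link is `starLink s μ out` with `μ` its direction (G1). -/
theorem eq_starLink_of_mem_vertexStar {s : Site d L} {x : Edge d L} (hx : x ∈ vertexStar s) :
    ∃ out : Bool, x = starLink s x.2 out := by
  rw [mem_vertexStar, mem_linkEnds] at hx
  rcases hx with h | h
  · exact ⟨true, Prod.ext (by simp [starLink, h]) rfl⟩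
  · exact ⟨false, Prod.ext (by simp [starLink, h, shift_def]) rfl⟩

omit [NeZero L] in
/-- **The `2d` star links are pairwise distinct** (torus of side `≥ 2`): `(μ, out) ↦ starLink s μ out`
is injective. -/
theorem starLink_injective (hL : 1 < L) (s : Site d L) :
    Injective fun p : Fin d × Bool => starLink s p.1 p.2 := by
  rintro ⟨μ, o⟩ ⟨ν, o'⟩ h
  simp only [starLink, Prod.mk.injEq] at h
  obtain ⟨h1, rfl⟩ := h
  cases o <;> cases o' <;> simp only [Bool.false_eq_true, ↓reduceIte] at h1
  · rfl
  · exact absurd (sub_eq_self.1 h1) (single_ne_zero' hL μ)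
  · exact absurd (sub_eq_self.1 h1.symm) (single_ne_zero' hL μ)
  · rfl

end Links

/-! ### The vertex star: opposite / non-opposite links, boundary links -/

section Star

variable [NeZero L]

/-- Membership in the vertex star, with the endpoint condition written as equations. -/
theorem mem_vertexStar_iff' {s : Site d L} {x : Edge d L} :
    x ∈ vertexStar s ↔ x.1 = s ∨ x.1.shift x.2 = s := by
  rw [mem_vertexStar, mem_linkEnds]
  constructor <;> rintro (h | h)
  · exact Or.inl h.symm
  · exact Or.inr h.symm
  · exact Or.inl h.symm
  · exact Or.inr h.symm

omit [NeZero L] in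
/-- An incoming star link: `p + e_μ = s` means `p = s − e_μ`. -/
theorem eq_sub_of_shift_eq {s p : Site d L} {μ : Fin d} (h : p.shift μ = s) :
    p = s - Pi.single μ 1 :=
  eq_sub_of_add_eq h

/-- **OPPOSITE star links share no plaquette**: two distinct star links with the same direction
are `(s, μ)` and `(s − e_μ, μ)` (side `≥ 2`). -/
theorem jointPlaq_eq_zero_of_vertexStar_of_snd_eq (hL : 1 < L) {s : Site d L} {x z : Edge d L}
    (hx : x ∈ vertexStar s) (hz : z ∈ vertexStar s) (hxz : x ≠ z) (hdir : x.2 = z.2) :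
    jointPlaq x z = 0 := by
  obtain ⟨p, μ⟩ := x
  obtain ⟨p', μ'⟩ := z
  simp only at hdir
  subst hdir
  rw [mem_vertexStar_iff'] at hx hz
  simp only at hx hz
  rcases hx with hx | hx <;> rcases hz with hz | hz
  · exact absurd (by rw [hx, hz]) hxz
  · -- `x = (s, μ)` outgoing, `z = (p', μ)` with `p' + e_μ = s`: `x = (p'.shift μ, μ)`
    have hp : p = p'.shift μ := hx.trans hz.symm
    rw [hp, jointPlaq_comm]
    exact jointPlaq_shift_self_eq_zero hL p' μ
  · have hp : p' = p.shift μ := hz.trans hx.symm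
    rw [hp]
    exact jointPlaq_shift_self_eq_zero hL p μ
  · refine absurd ?_ hxz
    rw [eq_sub_of_shift_eq hx, eq_sub_of_shift_eq hz]

/-- **NON-OPPOSITE star links share exactly one plaquette** (the star plaquette at the corner `s`
in their plane; side `≥ 3`). -/
theorem jointPlaq_eq_one_of_vertexStar_of_snd_ne (hL : 3 ≤ L) {s : Site d L} {x z : Edge d L}
    (hx : x ∈ vertexStar s) (hz : z ∈ vertexStar s) (hdir : x.2 ≠ z.2) : jointPlaq x z = 1 := by
  have hxz : x ≠ z := fun h => hdir (by rw [h])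
  obtain ⟨p, μ⟩ := x
  obtain ⟨p', ν⟩ := z
  simp only at hdir
  rw [mem_vertexStar_iff'] at hx hz
  simp only at hx hz
  -- the common plaquette is `plaqOf p μ ν _ pos`, on the side `pos` determined by `z`
  have main : ∀ pos : Bool, (p' = plaqBase p ν pos ∨ p' = (plaqBase p ν pos).shift μ) →
      jointPlaq ((p, μ) : Edge d L) (p', ν) = 1 := by
    intro pos hp'
    refine jointPlaq_eq_one_of_mem hL hxz (self_mem_plaqEdgesT_plaqOf p hdir pos)
      ((mem_plaqEdgesT_plaqOf hdir pos).2 ?_)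
    rcases hp' with hp' | hp'
    · exact Or.inr (Or.inr (Or.inr (by rw [hp'])))
    · exact Or.inr (Or.inl (by rw [hp']))
  rcases hx with hx | hx <;> rcases hz with hz | hz
  · -- both outgoing from `s = p = p'`: positive side, edge `(b, ν) = (p, ν)`
    exact main true (Or.inl (by simp [plaqBase, hz, hx]))
  · -- `x` outgoing (`p = s`), `z` incoming (`p' = s − e_ν`): negative side, edge `(b, ν)`
    exact main false (Or.inl (by simp [plaqBase, eq_sub_of_shift_eq hz, hx]))
  · -- `x` incoming (`p + e_μ = s`), `z` outgoing (`p' = s`): positive side, edge `(b + e_μ, ν)`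
    exact main true (Or.inr (by simp [plaqBase, hz, ← hx]))
  · -- both incoming: negative side, edge `(p − e_ν + e_μ, ν) = (s − e_ν, ν)`
    refine main false (Or.inr ?_)
    rw [eq_sub_of_shift_eq hz, ← hx]
    simp only [plaqBase, Bool.false_eq_true, ↓reduceIte, shift_def]
    abel

/-- A link off the star boundary (and off the star) shares no plaquette with a star link. -/
theorem jointPlaq_eq_zero_of_not_mem_starBoundary {s : Site d L} {x y : Edge d L}
    (hx : x ∈ vertexStar s) (hy : y ∉ vertexStar s) (hyb : y ∉ starBoundary s) :
    jointPlaq x y = 0 := by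
  rw [jointPlaq_eq_zero_iff]
  intro q hxq hyq
  exact hyb (mem_starBoundary.2 ⟨⟨q, mem_starPlaqs.2 ⟨x, hxq, hx⟩, hyq⟩, hy⟩)

/-- **The star plaquette through a boundary link is unique** (side `≥ 3`): if `y ∉ Λ⋆` lies on the
star plaquette `q`, then a star link `x` NOT on `q` shares no plaquette with `y`. (So the only star
links coupled to `y` by the tree's Dobrushin coefficients are the two star links of `q`.) -/
theorem jointPlaq_eq_zero_of_not_mem_starPlaq (hL : 3 ≤ L) {s : Site d L} {q : Plaquette d L}
    (hq : q ∈ starPlaqs s) {y : Edge d L} (hyq : y ∈ plaqEdgesT q) (hy : y ∉ vertexStar s)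
    {x : Edge d L} (hx : x ∈ vertexStar s) (hxq : x ∉ plaqEdgesT q) : jointPlaq x y = 0 := by
  haveI : Fact (1 < L) := ⟨by omega⟩
  rw [jointPlaq_eq_zero_iff]
  intro q' hxq' hyq'
  -- parametrize both plaquettes through `y = (p, l)`
  obtain ⟨p, l⟩ := y
  obtain ⟨κ, h, pos, rfl⟩ := exists_plaqOf_of_mem hyq
  obtain ⟨κ', h', pos', rfl⟩ := exists_plaqOf_of_mem hyq'
  obtain ⟨a, ha, has⟩ := mem_starPlaqs.1 hq
  have hs1 : s ≠ p := fun hh => hy (mem_vertexStar.2 (mem_linkEnds.2 (Or.inl hh)))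
  have hs2 : s ≠ p + Pi.single l 1 := fun hh => hy (mem_vertexStar.2 (mem_linkEnds.2 (Or.inr hh)))
  -- `s` is a corner of both plaquettes off `y`: `s − p ∈ {σe_κ, e_l + σe_κ} ∩ {σ'e_κ', e_l + σ'e_κ'}`
  have corner : ∀ {κ₀ : Fin d} (h₀ : l ≠ κ₀) (pos₀ : Bool) {e : Edge d L},
      e ∈ plaqEdgesT (plaqOf p l κ₀ h₀ pos₀) → s ∈ linkEnds e →
      s = p + signedSingle κ₀ pos₀ ∨ s = p + Pi.single l 1 + signedSingle κ₀ pos₀ := by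
    intro κ₀ h₀ pos₀ e he hse
    rcases linkEnds_plaqOf_subset h₀ pos₀ he hse with h1 | h1 | h1 | h1
    · exact absurd h1 hs1
    · exact absurd h1 hs2
    · exact Or.inl h1
    · exact Or.inr h1
  have h1 := corner h pos ha (mem_vertexStar.1 has)
  have h2 := corner h' pos' hxq' (mem_vertexStar.1 hx)
  have hκ : κ = κ' ∧ pos = pos' := by
    rcases h1 with h1 | h1 <;> rcases h2 with h2 | h2 <;> rw [h1] at h2
    · exact signedSingle_inj hL ((add_right_inj p).1 h2)
    · exfalso
      have h3 := congr_fun (sub_eq_zero.2 h2) l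
      simp [signedSingle_apply_of_ne h pos, signedSingle_apply_of_ne h' pos'] at h3
    · exfalso
      have h3 := congr_fun (sub_eq_zero.2 h2) l
      simp [signedSingle_apply_of_ne h pos, signedSingle_apply_of_ne h' pos'] at h3
    · exact signedSingle_inj hL ((add_right_inj _).1 h2)
  obtain ⟨rfl, rfl⟩ := hκ
  exact hxq hxq'

/-- **The star plaquette through a boundary link is unique** (`L ≥ 3`), stated for two star
plaquettes: if `y ∉ Λ⋆` lies on the star plaquettes `q` and `q'`, then `q = q'`. -/
theorem starPlaq_eq_of_mem_boundary (hL : 3 ≤ L) {s : Site d L} {q q' : Plaquette d L}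
    (hq : q ∈ starPlaqs s) (hq' : q' ∈ starPlaqs s) {y : Edge d L} (hy : y ∉ vertexStar s)
    (hyq : y ∈ plaqEdgesT q) (hyq' : y ∈ plaqEdgesT q') : q = q' := by
  obtain ⟨a, b, hab, hf⟩ := filter_mem_vertexStar_plaqEdgesT (by omega) hq'
  have ha : a ∈ (plaqEdgesT q').filter (fun e => e ∈ vertexStar s) := by rw [hf]; simp
  have hb : b ∈ (plaqEdgesT q').filter (fun e => e ∈ vertexStar s) := by rw [hf]; simp
  rw [mem_filter] at ha hb
  have key : ∀ {x : Edge d L}, x ∈ plaqEdgesT q' → x ∈ vertexStar s → x ∈ plaqEdgesT q := by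
    intro x hxq' hx
    by_contra hxq
    have h0 := jointPlaq_eq_zero_of_not_mem_starPlaq hL hq hyq hy hx hxq
    have hne : x ≠ y := fun h => hy (h ▸ hx)
    rw [jointPlaq_eq_one_of_mem hL hne hxq' hyq'] at h0
    exact one_ne_zero h0
  exact (eq_of_two_mem hL hab (key ha.1 ha.2) (key hb.1 hb.2) ha.1 hb.1)

/-- **Every star plaquette has exactly two boundary links** (torus of side `≥ 2`): its four edges are
two star links (`filter_mem_vertexStar_plaqEdgesT`) and two links off the star. -/
theorem card_filter_not_mem_vertexStar (hL : 1 < L) {s : Site d L} {q : Plaquette d L}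
    (hq : q ∈ starPlaqs s) : ((plaqEdgesT q).filter fun e => e ∉ vertexStar s).card = 2 := by
  have h4 := card_plaqEdgesT hL q
  obtain ⟨a, b, hab, hf⟩ := filter_mem_vertexStar_plaqEdgesT hL hq
  have h2 : ((plaqEdgesT q).filter fun e => e ∈ vertexStar s).card = 2 := by rw [hf, card_pair hab]
  have h := card_filter_add_card_filter_not (s := plaqEdgesT q) (fun e => e ∈ vertexStar s)
  omega

end Star

end Summit.Ventures.YMGap.StarKernel

end
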